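import Mathlib.Algebra.MvPolynomial.PDeriv
import Mathlib.Algebra.MvPolynomial.CommRing
import Mathlib.Algebra.Polynomial.AlgebraMap
import Mathlib.RingTheory.Polynomial.Basic
import Mathlib.LinearAlgebra.Matrix.Determinant.Basic
import Mathlib.Data.Finsupp.Weight
import HarnessLib

/-!
# Ruppert's linear map and matrix of a bivariate polynomial; generic plane sections

Topic `Literature/RingTheory/MvPolynomial`. Definitions-only support file for the
**Gao–Ruppert route to Kaltofen's effective Ostrowski theorem** (`kaltofen1995_thm8` of
`KaltofenNoetherForms.lean`), following W. M. Ruppert, *Reducibility of polynomials `f(x, y)`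
modulo `p`*, J. Number Theory 77 (1999) 62–70 = arXiv:math/9808021 [`Ruppert1999`], §2
(read in the held copy, pp. 4–5: Lemma 1, Lemma 2, the linear forms `g_{kl}`, the matrix `M(f)`
and "equation (1) has a nontrivial solution iff `M(f)` has rank `< 2mn+n−1`, i.e. all
`(2mn+n−1) × (2mn+n−1)`-submatrices of `M(f)` vanish"), in the TOTAL-DEGREE normalisation:

* `rupOp φ G H = φ ∂_Y G − G ∂_Y φ − φ ∂_X H + H ∂_X φ` — the numerator of
  `∂_Y(G/φ) − ∂_X(H/φ)` (Ruppert's "equation (1) can be written as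
  `∂r/∂y f − r ∂f/∂y − ∂s/∂x f + s ∂f/∂x = 0`"), for `φ, G, H ∈ R[X, Y] = MvPolynomial (Fin 2) R`
  (`X = X 0`, `Y = X 1`);
* `box k` — the exponents `e : Fin 2 →₀ ℕ` of total degree `≤ k`, and the column index type
  `Col d = Fin 2 × box (d - 1)` of the unknown pairs `(G, H)` with `deg G, deg H ≤ d − 1`;
* `rupMat d φ e' c` — the matrix of `(G, H) ↦ rupOp φ G H` on that box (rows indexed by all
  exponents `e'`; only finitely many rows are non-zero), whose entries are `ℤ`-linear in the
  coefficients of `φ` (Ruppert's `M(f)`);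
* `rupMinor d φ r c` — the determinant of the square submatrix with rows `r` and columns `c`;
* `Params n = Fin n ⊕ (Fin n ⊕ Fin n)` (parameters `z, μ, v`, in the order of
  `KaltofenNoetherFormsLemma7Proofs.irreducible_planeSection_of_algebraicIndependent`) and
  `planeSect f = f(μ + vX + zY) ∈ (A[z, μ, v])[X, Y]`, the generic plane section of
  `f ∈ A[x₁, …, xₙ]` with INDETERMINATE parameters (Kaltofen 1995, §5 Lemma 7).

Everything is defined over an arbitrary commutative ring and commutes with `MvPolynomial.map`
(`map_rupOp`, `rupMat_map`, `rupMinor_map`, `planeSect_map`): this is what lets one compare the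
matrix of `f` over `ℤ[ξ]` with those of `f^ξ` over `ℂ` and of `f mod ℘` over `F_℘`. The theorems
(Ruppert's Lemma 1 in the form "not irreducible ⟹ two independent kernel vectors", the
characteristic-zero converse "irreducible ⟹ kernel is the line through `(φ_X, φ_Y)`", and the
rank/minor dictionary) are proved in sibling `*Proofs.lean` files. No named facts here.

## References

* W. M. Ruppert, J. Number Theory 77 (1999) 62–70, §2. [`Ruppert1999`]
* E. Kaltofen, J. Comput. System Sci. 50 (1995) 274–295, §5 Lemma 7, §6 Thm. 8. [`Kaltofen1995`]
-/

noncomputable section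

open MvPolynomial

namespace Literature.RingTheory.MvPolynomial

namespace Ruppert

variable {R S : Type*} [CommRing R] [CommRing S]

/-! ### Ruppert's operator -/

/-- **Ruppert's operator** `R_φ(G, H) = φ ∂_Y G − G ∂_Y φ − φ ∂_X H + H ∂_X φ`, the numerator of
`∂_Y(G/φ) − ∂_X(H/φ)` (`X = X 0`, `Y = X 1`). [cite: Ruppert1999, §2 (equation (1))] -/
def rupOp (φ G H : MvPolynomial (Fin 2) R) : MvPolynomial (Fin 2) R :=
  φ * pderiv 1 G - G * pderiv 1 φ - φ * pderiv 0 H + H * pderiv 0 φ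

/-- Unfolding lemma. [folklore] -/
theorem rupOp_def (φ G H : MvPolynomial (Fin 2) R) :
    rupOp φ G H = φ * pderiv 1 G - G * pderiv 1 φ - φ * pderiv 0 H + H * pderiv 0 φ := rfl

/-- `R_φ(0, 0) = 0`. [folklore] -/
@[simp] theorem rupOp_zero (φ : MvPolynomial (Fin 2) R) : rupOp φ 0 0 = 0 := by
  simp [rupOp]

/-- `R_φ` is additive in the pair `(G, H)`. [folklore] -/
theorem rupOp_add (φ G₁ H₁ G₂ H₂ : MvPolynomial (Fin 2) R) :
    rupOp φ (G₁ + G₂) (H₁ + H₂) = rupOp φ G₁ H₁ + rupOp φ G₂ H₂ := by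
  simp only [rupOp, map_add]
  ring

/-- `R_φ` is homogeneous in the pair `(G, H)`. [folklore] -/
theorem rupOp_smul (φ G H : MvPolynomial (Fin 2) R) (c : R) :
    rupOp φ (c • G) (c • H) = c • rupOp φ G H := by
  simp only [rupOp, smul_eq_C_mul, pderiv_C_mul]
  ring

/-- `R_φ(C a · G, C a · H) = C a · R_φ(G, H)`. [folklore] -/
theorem rupOp_C_mul (φ G H : MvPolynomial (Fin 2) R) (a : R) :
    rupOp φ (C a * G) (C a * H) = C a * rupOp φ G H := by
  simp only [rupOp, pderiv_C_mul]
  ring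

/-- `R_φ` commutes with finite sums of pairs. [folklore] -/
theorem rupOp_sum {ι : Type*} (s : Finset ι) (φ : MvPolynomial (Fin 2) R)
    (G H : ι → MvPolynomial (Fin 2) R) :
    rupOp φ (∑ i ∈ s, G i) (∑ i ∈ s, H i) = ∑ i ∈ s, rupOp φ (G i) (H i) := by
  classical
  induction s using Finset.induction_on with
  | empty => simp
  | insert a s ha ih => rw [Finset.sum_insert ha, Finset.sum_insert ha, Finset.sum_insert ha,
      rupOp_add, ih]

/-- `R_φ` is linear in `φ` as well: scaling `φ` scales `R_φ`. [folklore] -/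
theorem rupOp_C_mul_left (φ G H : MvPolynomial (Fin 2) R) (a : R) :
    rupOp (C a * φ) G H = C a * rupOp φ G H := by
  simp only [rupOp, pderiv_C_mul]
  ring

/-- The two partial derivatives commute. [folklore] -/
theorem pderiv_zero_pderiv_one (p : MvPolynomial (Fin 2) R) :
    pderiv 0 (pderiv 1 p) = pderiv 1 (pderiv 0 p) := by
  ext m
  simp only [coeff_pderiv, Finsupp.coe_add, Pi.add_apply, Finsupp.single_apply]
  have h01 : ((0 : Fin 2) = 1) = False := by decide
  have h10 : ((1 : Fin 2) = 0) = False := by decide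
  simp only [h01, h10, if_false, add_zero]
  rw [add_right_comm]
  ring

/-- `(φ_X, φ_Y)` always lies in the kernel of `R_φ` (the closed form `dφ/φ`). [cite: Ruppert1999, §3 (proof of Lemma 2)] -/
theorem rupOp_pderiv_self (φ : MvPolynomial (Fin 2) R) :
    rupOp φ (pderiv 0 φ) (pderiv 1 φ) = 0 := by
  rw [rupOp, pderiv_zero_pderiv_one]
  ring

/-- `R_φ` commutes with a change of coefficient ring. [folklore] -/
theorem map_rupOp (f : R →+* S) (φ G H : MvPolynomial (Fin 2) R) :
    map f (rupOp φ G H) = rupOp (map f φ) (map f G) (map f H) := by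
  simp only [rupOp, map_sub, map_add, map_mul, pderiv_map]

/-! ### The box of exponents of bounded total degree and the column indices -/

/-- The exponents `e = (e₀, e₁)` with `e₀ + e₁ ≤ k` (total degree `≤ k`), as a `Finset`. [folklore] -/
def box (k : ℕ) : Finset (Fin 2 →₀ ℕ) :=
  ((Finset.range (k + 1)) ×ˢ (Finset.range (k + 1))).image
      (fun ab => Finsupp.single 0 ab.1 + Finsupp.single 1 ab.2) |>.filter
    (fun e => e.degree ≤ k)

/-- Membership in the box is `deg e ≤ k`. [folklore] -/
theorem mem_box {k : ℕ} {e : Fin 2 →₀ ℕ} : e ∈ box k ↔ e.degree ≤ k := by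
  constructor
  · intro h
    exact (Finset.mem_filter.mp h).2
  · intro h
    refine Finset.mem_filter.mpr ⟨?_, h⟩
    have hdeg : e.degree = e 0 + e 1 := by
      rw [Finsupp.degree_eq_sum]; simp [Fin.sum_univ_two]
    refine Finset.mem_image.mpr ⟨(e 0, e 1), ?_, ?_⟩
    · simp only [Finset.mem_product, Finset.mem_range]
      omega
    · ext i
      fin_cases i <;> simp

/-- The degree of an exponent of `Fin 2 →₀ ℕ` is `e₀ + e₁`. [folklore] -/
theorem degree_fin_two (e : Fin 2 →₀ ℕ) : e.degree = e 0 + e 1 := by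
  rw [Finsupp.degree_eq_sum]; simp [Fin.sum_univ_two]

/-- `totalDegree` is the maximum of `Finsupp.degree` over the support. [folklore] -/
theorem totalDegree_eq_sup_degree {σ : Type*} {A : Type*} [CommSemiring A] (p : MvPolynomial σ A) :
    p.totalDegree = p.support.sup Finsupp.degree := rfl

/-- A polynomial of total degree `≤ k` is supported in the box. [folklore] -/
theorem support_subset_box {k : ℕ} {p : MvPolynomial (Fin 2) R} (hp : p.totalDegree ≤ k) :
    p.support ⊆ box k := fun e he =>
  mem_box.mpr ((Finset.le_sup (f := Finsupp.degree) he).trans (by rwa [← totalDegree_eq_sup_degree]))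

/-- The column index type of the unknown pairs `(G, H)` with `deg G, deg H ≤ d − 1`: a tag
`0` (for `G`) or `1` (for `H`) and an exponent in the box. [cite: Ruppert1999, §2 (the unknowns u_{ij}, v_{ij})] -/
abbrev Col (d : ℕ) : Type := Fin 2 × (box (d - 1) : Finset (Fin 2 →₀ ℕ))

/-- The basis pair attached to a column: `(X^e, 0)` for tag `0`, `(0, X^e)` for tag `1`. [folklore] -/
def colPair (d : ℕ) (c : Col d) : MvPolynomial (Fin 2) R × MvPolynomial (Fin 2) R :=
  if c.1 = 0 then (monomial c.2.1 1, 0) else (0, monomial c.2.1 1)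

/-- **Ruppert's matrix** `M(φ)`: the entry in row `e'` (an exponent of the target) and column `c`
is the coefficient of `X^{e'}` in `R_φ` applied to the basis pair of `c`. [cite: Ruppert1999, §2 (the matrix M(f))] -/
def rupMat (d : ℕ) (φ : MvPolynomial (Fin 2) R) (e' : Fin 2 →₀ ℕ) (c : Col d) : R :=
  coeff e' (rupOp φ (colPair d c).1 (colPair d c).2)

/-- A **maximal-type minor** of Ruppert's matrix: rows `r`, columns `c`. [cite: Ruppert1999, §2 ("all (2mn+n−1)×(2mn+n−1)-submatrices")] -/
def rupMinor (d : ℕ) (φ : MvPolynomial (Fin 2) R) {m : ℕ} (r : Fin m → (Fin 2 →₀ ℕ))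
    (c : Fin m → Col d) : R :=
  (Matrix.of fun i j => rupMat d φ (r i) (c j)).det

/-- The basis pairs are mapped to basis pairs. [folklore] -/
theorem colPair_map (f : R →+* S) (d : ℕ) (c : Col d) :
    (map f (colPair (R := R) d c).1, map f (colPair (R := R) d c).2) = colPair (R := S) d c := by
  unfold colPair
  split_ifs <;> simp [map_monomial]

/-- The matrix commutes with a change of coefficient ring. [folklore] -/
theorem rupMat_map (f : R →+* S) (d : ℕ) (φ : MvPolynomial (Fin 2) R) (e' : Fin 2 →₀ ℕ)
    (c : Col d) : rupMat d (map f φ) e' c = f (rupMat d φ e' c) := by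
  unfold rupMat
  have h := colPair_map f d c
  rw [← coeff_map, map_rupOp, ← h]

/-- The minors commute with a change of coefficient ring. [folklore] -/
theorem rupMinor_map (f : R →+* S) (d : ℕ) (φ : MvPolynomial (Fin 2) R) {m : ℕ}
    (r : Fin m → (Fin 2 →₀ ℕ)) (c : Fin m → Col d) :
    rupMinor d (map f φ) r c = f (rupMinor d φ r c) := by
  unfold rupMinor
  rw [RingHom.map_det]
  congr 1
  ext i j
  simp [rupMat_map]

/-! ### The coefficient vector of a pair and the matrix identity -/

/-- The coefficient vector of a pair `(G, H)` on the columns. [folklore] -/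
def pairVec (d : ℕ) (G H : MvPolynomial (Fin 2) R) (c : Col d) : R :=
  if c.1 = 0 then coeff c.2.1 G else coeff c.2.1 H

/-- A pair in the box is the combination of the basis pairs with its coefficient vector (first
component). [folklore] -/
theorem sum_pairVec_colPair_fst {d : ℕ} {G H : MvPolynomial (Fin 2) R}
    (hG : G.totalDegree ≤ d - 1) :
    ∑ c : Col d, pairVec d G H c • (colPair (R := R) d c).1 = G := by
  classical
  rw [Fintype.sum_prod_type, Fin.sum_univ_two]
  simp only [pairVec, colPair, Fin.isValue, ↓reduceIte, one_ne_zero, smul_zero,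
    Finset.sum_const_zero, add_zero]
  rw [Finset.sum_coe_sort (box (d - 1)) (fun e => coeff e G • (monomial e (1 : R)))]
  conv_rhs => rw [G.as_sum]
  rw [← Finset.sum_subset (support_subset_box hG)]
  · refine Finset.sum_congr rfl fun e _ => ?_
    rw [smul_monomial, smul_eq_mul, mul_one]
  · intro e _ he
    rw [MvPolynomial.notMem_support_iff.mp he, zero_smul]

/-- A pair in the box is the combination of the basis pairs with its coefficient vector (second
component). [folklore] -/
theorem sum_pairVec_colPair_snd {d : ℕ} {G H : MvPolynomial (Fin 2) R}
    (hH : H.totalDegree ≤ d - 1) :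
    ∑ c : Col d, pairVec d G H c • (colPair (R := R) d c).2 = H := by
  classical
  rw [Fintype.sum_prod_type, Fin.sum_univ_two]
  simp only [pairVec, colPair, Fin.isValue, ↓reduceIte, one_ne_zero, smul_zero,
    Finset.sum_const_zero, zero_add]
  rw [Finset.sum_coe_sort (box (d - 1)) (fun e => coeff e H • (monomial e (1 : R)))]
  conv_rhs => rw [H.as_sum]
  rw [← Finset.sum_subset (support_subset_box hH)]
  · refine Finset.sum_congr rfl fun e _ => ?_
    rw [smul_monomial, smul_eq_mul, mul_one]
  · intro e _ he
    rw [MvPolynomial.notMem_support_iff.mp he, zero_smul]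

/-- **The matrix identity**: for a pair `(G, H)` in the box, the coefficients of `R_φ(G, H)`
are `M(φ)` applied to the coefficient vector. [cite: Ruppert1999, §2 ("We can write this as a matrix equation")] -/
theorem coeff_rupOp_eq_sum_rupMat {d : ℕ} (φ : MvPolynomial (Fin 2) R)
    {G H : MvPolynomial (Fin 2) R} (hG : G.totalDegree ≤ d - 1) (hH : H.totalDegree ≤ d - 1)
    (e' : Fin 2 →₀ ℕ) :
    coeff e' (rupOp φ G H) = ∑ c : Col d, rupMat d φ e' c * pairVec d G H c := by
  classical
  have key : rupOp φ G H = ∑ c : Col d, pairVec d G H c • rupOp φ (colPair d c).1 (colPair d c).2 :=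
    calc rupOp φ G H = rupOp φ (∑ c : Col d, pairVec d G H c • (colPair (R := R) d c).1)
          (∑ c : Col d, pairVec d G H c • (colPair (R := R) d c).2) := by
            rw [sum_pairVec_colPair_fst hG, sum_pairVec_colPair_snd hH]
      _ = ∑ c : Col d, pairVec d G H c • rupOp φ (colPair d c).1 (colPair d c).2 := by
            rw [rupOp_sum]
            exact Finset.sum_congr rfl fun c _ => rupOp_smul _ _ _ _
  rw [key, coeff_sum]
  refine Finset.sum_congr rfl fun c _ => ?_
  rw [coeff_smul, smul_eq_mul, mul_comm]
  rfl

/-- The pair `(G, H)` with a given coefficient vector on the columns. [folklore] -/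
def vecPair (d : ℕ) (x : Col d → R) : MvPolynomial (Fin 2) R × MvPolynomial (Fin 2) R :=
  (∑ c : Col d, x c • (colPair (R := R) d c).1, ∑ c : Col d, x c • (colPair (R := R) d c).2)

/-- First component of `vecPair`, as a sum of monomials over the box. [folklore] -/
theorem vecPair_fst (d : ℕ) (x : Col d → R) :
    (vecPair d x).1 = ∑ e : box (d - 1), monomial e.1 (x (0, e)) := by
  classical
  unfold vecPair
  simp only
  rw [Fintype.sum_prod_type, Fin.sum_univ_two]
  simp only [colPair, Fin.isValue, ↓reduceIte, one_ne_zero, smul_zero, Finset.sum_const_zero,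
    add_zero]
  exact Finset.sum_congr rfl fun e _ => by rw [smul_monomial, smul_eq_mul, mul_one]

/-- Second component of `vecPair`, as a sum of monomials over the box. [folklore] -/
theorem vecPair_snd (d : ℕ) (x : Col d → R) :
    (vecPair d x).2 = ∑ e : box (d - 1), monomial e.1 (x (1, e)) := by
  classical
  unfold vecPair
  simp only
  rw [Fintype.sum_prod_type, Fin.sum_univ_two]
  simp only [colPair, Fin.isValue, ↓reduceIte, one_ne_zero, smul_zero, Finset.sum_const_zero,
    zero_add]
  exact Finset.sum_congr rfl fun e _ => by rw [smul_monomial, smul_eq_mul, mul_one]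

/-- Coefficients of a sum of distinct monomials over the box. [folklore] -/
theorem coeff_sum_monomial_box (k : ℕ) (y : box k → R) (e : Fin 2 →₀ ℕ) :
    coeff e (∑ e' : box k, monomial e'.1 (y e')) =
      if h : e ∈ box k then y ⟨e, h⟩ else 0 := by
  classical
  rw [coeff_sum]
  simp only [coeff_monomial]
  split_ifs with h
  · rw [Finset.sum_eq_single ⟨e, h⟩]
    · simp
    · intro b _ hb
      rw [if_neg]
      exact fun heq => hb (Subtype.ext heq)
    · intro hh; exact absurd (Finset.mem_univ _) hh
  · refine Finset.sum_eq_zero fun b _ => ?_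
    rw [if_neg]
    intro heq
    exact h (heq ▸ b.2)

/-- The coefficient vector of `vecPair x` is `x`. [folklore] -/
theorem pairVec_vecPair (d : ℕ) (x : Col d → R) :
    pairVec d (vecPair d x).1 (vecPair d x).2 = x := by
  classical
  funext c
  obtain ⟨i, e⟩ := c
  unfold pairVec
  simp only
  rw [vecPair_fst, vecPair_snd, coeff_sum_monomial_box, coeff_sum_monomial_box]
  simp only [Finset.coe_mem, ↓reduceDIte, Subtype.coe_eta]
  fin_cases i <;> simp

/-- The components of `vecPair x` have total degree `≤ d − 1`. [folklore] -/
theorem totalDegree_vecPair_le (d : ℕ) (x : Col d → R) :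
    (vecPair d x).1.totalDegree ≤ d - 1 ∧ (vecPair d x).2.totalDegree ≤ d - 1 := by
  classical
  rw [vecPair_fst, vecPair_snd]
  constructor <;>
  · refine (totalDegree_finsetSum _ _).trans (Finset.sup_le fun e _ => ?_)
    exact (totalDegree_monomial_le _ _).trans (mem_box.mp e.2)

/-- A pair in the box is recovered from its coefficient vector. [folklore] -/
theorem vecPair_pairVec {d : ℕ} {G H : MvPolynomial (Fin 2) R} (hG : G.totalDegree ≤ d - 1)
    (hH : H.totalDegree ≤ d - 1) : vecPair d (pairVec d G H) = (G, H) := by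
  unfold vecPair
  rw [sum_pairVec_colPair_fst hG, sum_pairVec_colPair_snd hH]

/-- `vecPair` is additive. [folklore] -/
theorem vecPair_add (d : ℕ) (x y : Col d → R) :
    vecPair d (x + y) = vecPair d x + vecPair d y := by
  unfold vecPair
  simp only [Pi.add_apply, add_smul, Finset.sum_add_distrib, Prod.mk_add_mk]

/-- `vecPair` is homogeneous. [folklore] -/
theorem vecPair_smul (d : ℕ) (a : R) (x : Col d → R) :
    vecPair d (a • x) = (a • (vecPair d x).1, a • (vecPair d x).2) := by
  unfold vecPair
  simp only [Pi.smul_apply, smul_eq_mul, mul_smul, Finset.smul_sum]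

/-- **The matrix identity for coefficient vectors**: the coefficients of `R_φ` on the pair with
coefficient vector `x` are `M(φ) x`. [cite: Ruppert1999, §2 ("We can write this as a matrix equation")] -/
theorem coeff_rupOp_vecPair (d : ℕ) (φ : MvPolynomial (Fin 2) R) (x : Col d → R)
    (e' : Fin 2 →₀ ℕ) :
    coeff e' (rupOp φ (vecPair d x).1 (vecPair d x).2) = ∑ c : Col d, rupMat d φ e' c * x c := by
  have h := totalDegree_vecPair_le d x
  rw [coeff_rupOp_eq_sum_rupMat φ h.1 h.2, pairVec_vecPair]

/-! ### `R[X, Y] ≃ R[Y][X]` -/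

/-- The identification `R[X, Y] ≃ R[Y][X]` used throughout: `X = X 0 ↦ X` (the outer variable),
`Y = X 1 ↦ C X` (the inner variable). [folklore] -/
def finTwoEquiv (R : Type*) [CommRing R] : MvPolynomial (Fin 2) R ≃ₐ[R] Polynomial (Polynomial R) :=
  AlgEquiv.ofAlgHom
    (aeval (Fin.cons Polynomial.X fun _ => Polynomial.C Polynomial.X))
    (Polynomial.aevalTower (Polynomial.aeval (X 1 : MvPolynomial (Fin 2) R)) (X 0))
    (by
      refine Polynomial.algHom_ext' (Polynomial.algHom_ext ?_) ?_
      · simp only [AlgHom.coe_comp, Function.comp_apply, Polynomial.CAlgHom, AlgHom.coe_mk,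
          Polynomial.aevalTower_C, Polynomial.aeval_X, aeval_X, AlgHom.coe_id, id_eq]
        rfl
      · simp only [AlgHom.coe_comp, Function.comp_apply, Polynomial.aevalTower_X, aeval_X,
          AlgHom.coe_id, id_eq]
        rfl)
    (by
      refine algHom_ext fun i => ?_
      simp only [AlgHom.coe_comp, Function.comp_apply, aeval_X, AlgHom.coe_id, id_eq]
      refine Fin.cases ?_ (fun j => ?_) i
      · simp only [Fin.cons_zero, Polynomial.aevalTower_X]
      · simp only [Fin.cons_succ, Polynomial.aevalTower_C, Polynomial.aeval_X]
        congr 1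
        exact Fin.ext (by have := j.isLt; simp only [Fin.val_succ, Fin.val_one]; omega))

/-- `X ↦ X`. [folklore] -/
@[simp] theorem finTwoEquiv_X_zero (R : Type*) [CommRing R] :
    finTwoEquiv R (X 0) = Polynomial.X := by
  simp [finTwoEquiv]

/-- `Y ↦ C X`. [folklore] -/
@[simp] theorem finTwoEquiv_X_one (R : Type*) [CommRing R] :
    finTwoEquiv R (X 1) = Polynomial.C Polynomial.X := by
  simp only [finTwoEquiv, AlgEquiv.ofAlgHom_apply, aeval_X]
  rfl

/-- Constants go to constants. [folklore] -/
@[simp] theorem finTwoEquiv_C (R : Type*) [CommRing R] (a : R) :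
    finTwoEquiv R (C a) = Polynomial.C (Polynomial.C a) := by
  simp only [finTwoEquiv, AlgEquiv.ofAlgHom_apply, algHom_C, Polynomial.algebraMap_apply]
  rfl

/-- The image of a monomial `a X^i Y^j` is `C (C a * X^j) * X^i`. [folklore] -/
theorem finTwoEquiv_monomial (R : Type*) [CommRing R] (e : Fin 2 →₀ ℕ) (a : R) :
    finTwoEquiv R (monomial e a) =
      Polynomial.C (Polynomial.C a * Polynomial.X ^ (e 1)) * Polynomial.X ^ (e 0) := by
  rw [monomial_eq, map_mul, finTwoEquiv_C, Finsupp.prod_pow, Fin.prod_univ_two, map_mul, map_pow,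
    map_pow, finTwoEquiv_X_zero, finTwoEquiv_X_one, Polynomial.C_mul, Polynomial.C_pow]
  ring

/-- **Coefficient formula**: the coefficient of `X^i` then `Y^j` of the image is the coefficient
of `X^i Y^j`. [folklore] -/
theorem coeff_coeff_finTwoEquiv (R : Type*) [CommRing R] (p : MvPolynomial (Fin 2) R) (i j : ℕ) :
    ((finTwoEquiv R p).coeff i).coeff j = p.coeff (Finsupp.single 0 i + Finsupp.single 1 j) := by
  classical
  induction p using MvPolynomial.induction_on' with
  | monomial e a =>
    rw [finTwoEquiv_monomial, Polynomial.coeff_C_mul_X_pow, coeff_monomial]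
    by_cases h : e = Finsupp.single 0 i + Finsupp.single 1 j
    · subst h
      simp
    · rw [if_neg h]
      split_ifs with hi
      · rw [Polynomial.coeff_C_mul_X_pow, if_neg]
        intro hj
        apply h
        ext t
        fin_cases t <;> simp [hi, hj]
      · exact Polynomial.coeff_zero j
  | add p q hp hq => rw [map_add, Polynomial.coeff_add, Polynomial.coeff_add, hp, hq, coeff_add]

/-! ### Generic plane sections -/

/-- The parameters `(z, μ, v)` of a plane `xᵢ = μᵢ + vᵢ X + zᵢ Y`, `3n` indeterminates, ordered as
in `irreducible_planeSection_of_algebraicIndependent` (`Sum.elim z (Sum.elim μ v)`). [cite: Kaltofen1995, §5 Lemma 7] -/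
abbrev Params (n : ℕ) : Type := Fin n ⊕ (Fin n ⊕ Fin n)

/-- The linear form `μᵢ + vᵢ X + zᵢ Y` substituted for `xᵢ`. [cite: Kaltofen1995, §5 Lemma 7] -/
def sectSubst {A : Type*} [CommRing A] (n : ℕ) (i : Fin n) :
    MvPolynomial (Fin 2) (MvPolynomial (Params n) A) :=
  C (X (Sum.inr (Sum.inl i))) + C (X (Sum.inr (Sum.inr i))) * X 0 + C (X (Sum.inl i)) * X 1

/-- **The generic plane section** `f(μ + vX + zY) ∈ (A[z, μ, v])[X, Y]` of `f ∈ A[x₁, …, xₙ]`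
(indeterminate parameters). [cite: Kaltofen1995, §5 Lemma 7] -/
def planeSect {A : Type*} [CommRing A] {n : ℕ} (f : MvPolynomial (Fin n) A) :
    MvPolynomial (Fin 2) (MvPolynomial (Params n) A) :=
  eval₂ (C.comp C) (sectSubst n) f

/-- The section is a ring homomorphism in `f`. [folklore] -/
theorem planeSect_eq_eval₂Hom {A : Type*} [CommRing A] {n : ℕ} (f : MvPolynomial (Fin n) A) :
    planeSect f = eval₂Hom (C.comp C) (sectSubst n) f := rfl

/-- The substituted linear forms are mapped to themselves by a change of scalars. [folklore] -/
theorem map_map_sectSubst {A B : Type*} [CommRing A] [CommRing B] (g : A →+* B) (n : ℕ) (i : Fin n) :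
    map (map g) (sectSubst (A := A) n i) = sectSubst (A := B) n i := by
  simp [sectSubst, map_X, map_C]

/-- **The section commutes with a change of scalars** `A → B` (applied to the coefficients of
`f` and to the coefficients of the parameter polynomials). [folklore] -/
theorem planeSect_map {A B : Type*} [CommRing A] [CommRing B] (g : A →+* B) {n : ℕ}
    (f : MvPolynomial (Fin n) A) :
    planeSect (map g f) = map (map g) (planeSect f) := by
  have key : (eval₂Hom (C.comp C) (sectSubst (A := B) n)).comp (map g) =
      (map (map g)).comp (eval₂Hom (C.comp C) (sectSubst (A := A) n)) := by
    refine ringHom_ext (fun a => ?_) (fun i => ?_)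
    · simp only [RingHom.coe_comp, Function.comp_apply, map_C, eval₂Hom_C]
    · simp only [RingHom.coe_comp, Function.comp_apply, map_X, eval₂Hom_X', map_map_sectSubst]
  exact DFunLike.congr_fun key f

end Ruppert

end Literature.RingTheory.MvPolynomial

end
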